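import Summits.RiemannHypothesis.RiemannHypothesis.Theorems.Splittings.RobinFiniteE1cZeroSplit
import HarnessLib

/-!
# Splittings — Robin finite lens, E1c⁻ part 3/4: the RH-FREE explicit formula for Nicolas's `J` in LIMIT form
# (SPLIT-robin-finite gen 5; zero-definition raw form)

Cell rh-split, seat rh-split-robin-finite g5 (brief sha16 f79c5f09d8bcb036), card
`run/shared/lean/pub/rh-split/cards/SPLIT-robin-finite.md` §12; zero-definition raw form of
`HOME/rh-split-robin-finite/SketchG5-E1c.lean` (sha16 a141f2e32dd4cace; referee CONTENT REPLAY PASS rh-split-ref g2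
2026-08-27T03:02:44Z: farm rc 0 / 0 warn / 0 sorry, std axioms on `E1c.partialNicolasLower_PT`,
`E1c.nicolasLowerBetween_PT`, `E1c.schoenfeldThetaOn_of_buthe2016`), filed by rh-split-typer-1 g4.  The scratch's 15
interface `def`s (`nicolasEWith`, `SchoenfeldThetaOn`, `OffLineSumAt`, `budgetPw`, `PartialExplicitCorePwLower`,
`ExplicitFormulaFree`, `ZeroSplitBound`, `PsiSubThetaFree`, `termSum`, `OffLineSumOn`, `NicolasLowerBetween`,
`PartialNicolasBetween`, `ZeroTailBound`, `lehmanH`, `lehmanTail`) are SPELLED OUT VERBATIM at every site; proofs are the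
scratch's, with only the `unfold`/`rw` steps of the spelled-out abbreviations removed.
HONEST LABEL: «SPLITTING SEARCH over kernel-typed RH-EQUIVALENCES; a splitting A ∧ B ⟹ RH is CONDITIONAL bookkeeping
unless A and B are both proved; nothing here bears on the truth of RH.»

This part: S1 of the seam census — the GLOBAL majorant `|ψ₁(t) − t²/2| ≤ C t^{3/2}` (`exists_abs_Rone_le_of_RH`), used in
the tree only to make the Bochner integral `nicolasJ` converge (`cor21_upperRH`), is ELIMINATED: for `1 < x ≤ X`,
`∫_x^X (ψ − t)w₀ = R₁w₀|_x^X − ∫_x^X R₁w₀'` (tree), `R₁ = −Z − (log 2π)t + E` (tree, RH-free), and on the FINITE interval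
the zero sum interchanges with the integral absolutely (`‖zeroTerm ρ t‖ ≤ X²‖zeroTerm ρ 1‖`), each zero contributing
`−(m/ρ)(F_ρ(x) − F_ρ(X))` by `one_zero` at `x` and at `X` (`one_zero_interval`, `zeros_part_interval`); the tail
`Σ_ρ (m/ρ)F_ρ(X)` is `O(1/log X)` by the RH-free per-zero bound of part 2 (`norm_tsum_term_le`, `tendsto_termSum`), so
`lim_X ∫_x^X (ψ − t)w₀` exists and is `≥ Re(−Σ_ρ (m/ρ)F_ρ(x)) − log(2π)/(x log x)` with NO global hypothesis on `R₁`
(`explicitFormulaFree_holds` = scratch `ExplicitFormulaFree`, spelled out; Nicolas 1983 §2, Nicolas 2012 (1.16)–(1.19),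
(2.14)).  RH-free ingredients in tree: `one_zero`, `summable_zeroTerm`, `linear_term`, `re_remainder_bracket_nonpos`,
`integral_R_mul_w0_eq`, `FordL33` / `tsum_zeroOrder_div_norm_sq_le`.  The scratch's abbreviation
`termSum y := Σ_ρ (m/ρ)F_ρ(y)` is spelled out.
-/

set_option linter.dupNamespace false

noncomputable section

open Complex Filter Set MeasureTheory Topology intervalIntegral
open scoped Real Chebyshev ComplexConjugate

namespace Summit.RiemannHypothesis.RiemannHypothesis.Theorems.Splittings.RobinFiniteE1c

open Literature.NumberTheory.LFunctions Literature.NumberTheory.DiophantineGeometry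
open NicolasJ NicolasFz NicolasK NicolasJExplicit

/-! ### The tail `Σ_ρ (m/ρ)F_ρ(X) → 0` (RH-free) -/

/-- Off-line weight versus Ford's weight: `m x^{β−1/2}/γ² ≤ 2√x · m/|ρ|²` (`x > 1`). -/
theorem offWeight_le (ρ : Zeros) {x : ℝ} (hx : 1 < x) :
    (riemannZetaZeroOrder (ρ : ℂ) : ℝ) * x ^ ((ρ : ℂ).re - 1 / 2) / (ρ : ℂ).im ^ 2 ≤
      2 * Real.sqrt x * ((riemannZetaZeroOrder (ρ : ℂ) : ℝ) / ‖(ρ : ℂ)‖ ^ 2) := by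
  have hm := FordL33.order_pos ρ
  have hγ : 14 < |(ρ : ℂ).im| := FordL33.fourteen_lt_abs_im ρ
  have hre0 : 0 < (ρ : ℂ).re := ZetaZeros.riemannZetaNontrivialZeros.re_pos ρ.2
  have hre1 : (ρ : ℂ).re < 1 := ZetaZeros.riemannZetaNontrivialZeros.re_lt_one ρ.2
  have hpow : x ^ ((ρ : ℂ).re - 1 / 2) ≤ Real.sqrt x := by
    rw [Real.sqrt_eq_rpow]
    exact Real.rpow_le_rpow_of_exponent_le hx.le (by linarith)
  have hnorm : ‖(ρ : ℂ)‖ ^ 2 ≤ 2 * (ρ : ℂ).im ^ 2 := by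
    rw [Complex.sq_norm, Complex.normSq_apply]
    have hγ2 : 14 ^ 2 < (ρ : ℂ).im ^ 2 := by
      calc (14 : ℝ) ^ 2 < |(ρ : ℂ).im| ^ 2 := by gcongr
        _ = _ := sq_abs _
    nlinarith
  have hγpos : 0 < (ρ : ℂ).im ^ 2 := by
    have : 0 < |(ρ : ℂ).im| := by linarith
    rw [← sq_abs]; positivity
  have hnpos : 0 < ‖(ρ : ℂ)‖ ^ 2 := by
    have := FordL33.fourteen_lt_norm ρ; positivity
  calc (riemannZetaZeroOrder (ρ : ℂ) : ℝ) * x ^ ((ρ : ℂ).re - 1 / 2) / (ρ : ℂ).im ^ 2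
      ≤ (riemannZetaZeroOrder (ρ : ℂ) : ℝ) * Real.sqrt x / (ρ : ℂ).im ^ 2 := by gcongr
    _ ≤ (riemannZetaZeroOrder (ρ : ℂ) : ℝ) * Real.sqrt x * (2 / ‖(ρ : ℂ)‖ ^ 2) := by
        rw [div_eq_mul_one_div]
        refine mul_le_mul_of_nonneg_left ?_ (by positivity)
        rw [div_le_div_iff₀ hγpos hnpos]; linarith
    _ = 2 * Real.sqrt x * ((riemannZetaZeroOrder (ρ : ℂ) : ℝ) / ‖(ρ : ℂ)‖ ^ 2) := by ring

/-- Every term against Ford's weight: `‖(m/ρ)F_ρ(y)‖ ≤ 2(1 + 2/log y)/log y · m/|ρ|²` (`y > 1`, RH-free). -/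
theorem norm_term_le_ford (ρ : Zeros) {y : ℝ} (hy : 1 < y) :
    ‖(riemannZetaZeroOrder (ρ : ℂ) : ℂ) / (ρ : ℂ) * Fz (ρ : ℂ) y‖ ≤
      2 * ((1 + 2 / Real.log y) / Real.log y) * ((riemannZetaZeroOrder (ρ : ℂ) : ℝ) / ‖(ρ : ℂ)‖ ^ 2) := by
  have hy0 : 0 < y := by linarith
  have hly : 0 < Real.log y := Real.log_pos hy
  have hsy : 0 < Real.sqrt y := Real.sqrt_pos.2 hy0
  have h1 := offline_term_le ρ hy
  have h2 := offWeight_le ρ hy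
  have hc : 0 ≤ (1 + 2 / Real.log y) / (Real.sqrt y * Real.log y) := by positivity
  calc _ ≤ (1 + 2 / Real.log y) / (Real.sqrt y * Real.log y) *
        (2 * Real.sqrt y * ((riemannZetaZeroOrder (ρ : ℂ) : ℝ) / ‖(ρ : ℂ)‖ ^ 2)) :=
        h1.trans (mul_le_mul_of_nonneg_left h2 hc)
    _ = _ := by field_simp

/-- **Summability of `Σ_ρ (m/ρ)F_ρ(y)`, RH-free** (`y > 1`). -/
theorem summable_term {y : ℝ} (hy : 1 < y) :
    Summable (fun ρ : Zeros ↦ (riemannZetaZeroOrder (ρ : ℂ) : ℂ) / (ρ : ℂ) * Fz (ρ : ℂ) y) :=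
  (FordL33.summable_order_div_norm_sq.mul_left _).of_norm_bounded fun ρ ↦ norm_term_le_ford ρ hy

/-- The tail: `‖Σ_ρ (m/ρ)F_ρ(y)‖ ≤ 2(1 + 2/log y)/log y · 0.0463` (`y > 1`, RH-free). -/
theorem norm_tsum_term_le {y : ℝ} (hy : 1 < y) :
    ‖∑' ρ : Zeros, (riemannZetaZeroOrder (ρ : ℂ) : ℂ) / (ρ : ℂ) * Fz (ρ : ℂ) y‖ ≤
      2 * ((1 + 2 / Real.log y) / Real.log y) * 0.0463 := by
  have hly : 0 < Real.log y := Real.log_pos hy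
  have hF := FordL33.summable_order_div_norm_sq
  have hmaj : Summable fun ρ : Zeros ↦
      2 * ((1 + 2 / Real.log y) / Real.log y) * ((riemannZetaZeroOrder (ρ : ℂ) : ℝ) / ‖(ρ : ℂ)‖ ^ 2) :=
    hF.mul_left _
  have hn : Summable fun ρ : Zeros ↦ ‖(riemannZetaZeroOrder (ρ : ℂ) : ℂ) / (ρ : ℂ) * Fz (ρ : ℂ) y‖ :=
    hmaj.of_nonneg_of_le (fun ρ ↦ norm_nonneg _) fun ρ ↦ norm_term_le_ford ρ hy
  calc _ ≤ ∑' ρ : Zeros, ‖(riemannZetaZeroOrder (ρ : ℂ) : ℂ) / (ρ : ℂ) * Fz (ρ : ℂ) y‖ :=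
        norm_tsum_le_tsum_norm hn
    _ ≤ ∑' ρ : Zeros, 2 * ((1 + 2 / Real.log y) / Real.log y) *
          ((riemannZetaZeroOrder (ρ : ℂ) : ℝ) / ‖(ρ : ℂ)‖ ^ 2) :=
        hn.tsum_le_tsum (fun ρ ↦ norm_term_le_ford ρ hy) hmaj
    _ = 2 * ((1 + 2 / Real.log y) / Real.log y) *
          ∑' ρ : Zeros, ((riemannZetaZeroOrder (ρ : ℂ) : ℝ) / ‖(ρ : ℂ)‖ ^ 2) := tsum_mul_left
    _ ≤ _ := mul_le_mul_of_nonneg_left tsum_zeroOrder_div_norm_sq_le (by positivity)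

/-- The tail vanishes: `Σ_ρ (m/ρ)F_ρ(X) → 0` as `X → ∞` (RH-free; scratch `tendsto_termSum` with `termSum` spelled out). -/
theorem tendsto_termSum :
    Tendsto (fun y : ℝ ↦ ∑' ρ : Zeros, (riemannZetaZeroOrder (ρ : ℂ) : ℂ) / (ρ : ℂ) * Fz (ρ : ℂ) y) atTop (𝓝 0) := by
  have h0 : Tendsto (fun X : ℝ ↦ (Real.log X)⁻¹) atTop (𝓝 0) := Real.tendsto_log_atTop.inv_tendsto_atTop
  have hb : Tendsto (fun X : ℝ ↦ 2 * ((1 + 2 * (Real.log X)⁻¹) * (Real.log X)⁻¹) * 0.0463) atTop (𝓝 0) := by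
    have h1 : Tendsto (fun X : ℝ ↦ (1 + 2 * (Real.log X)⁻¹) * (Real.log X)⁻¹) atTop (𝓝 ((1 + 2 * 0) * 0)) :=
      ((h0.const_mul 2).const_add 1).mul h0
    have h2 := (h1.const_mul 2).mul_const 0.0463
    simpa using h2
  refine squeeze_zero_norm' ?_ hb
  filter_upwards [eventually_gt_atTop 1] with X hX
  have h := norm_tsum_term_le hX
  have e : (1 + 2 / Real.log X) / Real.log X = (1 + 2 * (Real.log X)⁻¹) * (Real.log X)⁻¹ := by
    rw [div_eq_mul_inv, div_eq_mul_inv]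
  rw [e] at h
  exact h

/-! ### The zeros' part on a finite interval (RH-free interchange) -/

/-- Interval integral as a difference of two tails (`g` integrable on `(x, ∞)`, `x ≤ X`). -/
theorem intervalIntegral_eq_Ioi_sub_Ioi {g : ℝ → ℂ} {x X : ℝ} (hg : IntegrableOn g (Ioi x)) (hxX : x ≤ X) :
    ∫ t in x..X, g t = (∫ t in Ioi x, g t) - ∫ t in Ioi X, g t := by
  rw [intervalIntegral.integral_of_le hxX]
  have h : ∫ t in Ioi x, g t = (∫ t in Ioc x X, g t) + ∫ t in Ioi X, g t := by
    rw [← setIntegral_union Ioc_disjoint_Ioi_same measurableSet_Ioi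
      (hg.mono_set Ioc_subset_Ioi_self) (hg.mono_set (Ioi_subset_Ioi hxX)), Ioc_union_Ioi_eq_Ioi hxX]
  rw [h]; ring

/-- **One zero on a finite interval** (RH-free): for `1 < x ≤ X`,
`zeroTerm ρ x·w₀(x) + ∫_x^X zeroTerm ρ·w₀' − zeroTerm ρ X·w₀(X) = −(m/ρ)F_ρ(x) + (m/ρ)F_ρ(X)`. -/
theorem one_zero_interval (ρ : Zeros) {x X : ℝ} (hx : 1 < x) (hxX : x ≤ X) :
    zeroTerm ρ x * (w0 x : ℂ) + (∫ t in x..X, zeroTerm ρ t * (w0' t : ℂ)) - zeroTerm ρ X * (w0 X : ℂ) =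
      -((riemannZetaZeroOrder (ρ : ℂ) : ℂ) / (ρ : ℂ) * Fz (ρ : ℂ) x) +
        (riemannZetaZeroOrder (ρ : ℂ) : ℂ) / (ρ : ℂ) * Fz (ρ : ℂ) X := by
  have hX : 1 < X := hx.trans_le hxX
  -- per point: the tree's bracket on `(y, ∞)`
  have hper : ∀ y : ℝ, 1 < y → zeroTerm ρ y * (w0 y : ℂ) + ∫ t in Ioi y, zeroTerm ρ t * (w0' t : ℂ) =
      -((riemannZetaZeroOrder (ρ : ℂ) : ℂ) / (ρ : ℂ) * Fz (ρ : ℂ) y) := by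
    intro y hy
    have hρ0 : (ρ : ℂ) ≠ 0 := ne_zero ρ.2
    have hρ1 : (ρ : ℂ) + 1 ≠ 0 := add_one_ne_zero ρ.2
    have h1 := one_zero (re_pos ρ.2) (re_lt_one ρ.2) hy (ρ := (ρ : ℂ))
    have hint : ∫ t in Ioi y, zeroTerm ρ t * (w0' t : ℂ) =
        (riemannZetaZeroOrder (ρ : ℂ) : ℂ) / ((ρ : ℂ) * (ρ + 1)) *
          ∫ t in Ioi y, (t : ℂ) ^ ((ρ : ℂ) + 1) * (w0' t : ℂ) := by
      rw [← MeasureTheory.integral_const_mul]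
      exact integral_congr_ae (ae_of_all _ fun t ↦ zeroTerm_mul_w0' ρ t)
    rw [hint, zeroTerm]
    have e : (riemannZetaZeroOrder (ρ : ℂ) : ℂ) * ((y : ℂ) ^ ((ρ : ℂ) + 1) / ((ρ : ℂ) * (ρ + 1))) * (w0 y : ℂ) +
        (riemannZetaZeroOrder (ρ : ℂ) : ℂ) / ((ρ : ℂ) * (ρ + 1)) *
          ∫ t in Ioi y, (t : ℂ) ^ ((ρ : ℂ) + 1) * (w0' t : ℂ) =
        (riemannZetaZeroOrder (ρ : ℂ) : ℂ) / ((ρ : ℂ) * (ρ + 1)) *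
          ((y : ℂ) ^ ((ρ : ℂ) + 1) * (w0 y : ℂ) + ∫ t in Ioi y, (t : ℂ) ^ ((ρ : ℂ) + 1) * (w0' t : ℂ)) := by
      field_simp
    rw [e, h1]
    field_simp
  have hsplit := intervalIntegral_eq_Ioi_sub_Ioi (integrableOn_zeroTerm_mul_w0' ρ hx) hxX
  have hx' := hper x hx
  have hX' := hper X hX
  rw [hsplit]
  linear_combination hx' - hX'

/-- Uniform bound on `[x, X]`: `‖zeroTerm ρ t · w₀'(t)‖ ≤ X²·M_x·‖zeroTerm ρ 1‖` (`1 < x ≤ t ≤ X`). -/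
theorem norm_zeroTerm_mul_w0'_le (ρ : Zeros) {x X t : ℝ} (hx : 1 < x) (ht : t ∈ Ioc x X) :
    ‖zeroTerm ρ t * (w0' t : ℂ)‖ ≤ X ^ 2 * Mw x * ‖zeroTerm ρ 1‖ := by
  have ht1 : 1 < t := hx.trans ht.1
  have h1 := norm_zeroTerm_le_sq_mul ρ (X := X) (t := t) ⟨ht1.le, ht.2⟩
  have h2 := abs_w0'_le_rpow hx ht.1.le
  have hM := Mw_nonneg hx
  have ht3 : t ^ (-3 : ℝ) ≤ 1 := Real.rpow_le_one_of_one_le_of_nonpos ht1.le (by norm_num)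
  rw [norm_mul, Complex.norm_real, Real.norm_eq_abs]
  calc ‖zeroTerm ρ t‖ * |w0' t| ≤ (X ^ 2 * ‖zeroTerm ρ 1‖) * (Mw x * t ^ (-3 : ℝ)) :=
        mul_le_mul h1 h2 (abs_nonneg _) (by positivity)
    _ ≤ (X ^ 2 * ‖zeroTerm ρ 1‖) * (Mw x * 1) := by gcongr
    _ = X ^ 2 * Mw x * ‖zeroTerm ρ 1‖ := by ring

/-- **Interchange on a finite interval** (RH-free): `∫_x^X Z·w₀' = Σ_ρ ∫_x^X zeroTerm ρ·w₀'` (`1 < x ≤ X`). -/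
theorem integral_Zsum_mul_w0'_interval {x X : ℝ} (hx : 1 < x) (hxX : x ≤ X) :
    ∫ t in x..X, Zsum t * (w0' t : ℂ) = ∑' ρ : Zeros, ∫ t in x..X, zeroTerm ρ t * (w0' t : ℂ) := by
  simp_rw [intervalIntegral.integral_of_le hxX]
  have hs1 : Summable fun ρ : Zeros ↦ ‖zeroTerm ρ 1‖ := by
    have h := summable_norm_psiOne_zeroTerm (x := 1) le_rfl
    simpa [zeroTerm] using h
  have hbound : ∀ ρ : Zeros, ∫ t in Ioc x X, ‖zeroTerm ρ t * (w0' t : ℂ)‖ ≤ (X - x) * (X ^ 2 * Mw x * ‖zeroTerm ρ 1‖) := by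
    intro ρ
    have hi : IntegrableOn (fun t : ℝ ↦ zeroTerm ρ t * (w0' t : ℂ)) (Ioc x X) :=
      (integrableOn_zeroTerm_mul_w0' ρ hx).mono_set Ioc_subset_Ioi_self
    calc ∫ t in Ioc x X, ‖zeroTerm ρ t * (w0' t : ℂ)‖ ≤ ∫ t in Ioc x X, X ^ 2 * Mw x * ‖zeroTerm ρ 1‖ := by
          refine setIntegral_mono_on hi.norm (integrableOn_const (measure_Ioc_lt_top (μ := volume)).ne)
            measurableSet_Ioc fun t ht ↦ norm_zeroTerm_mul_w0'_le ρ hx ht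
      _ = (X - x) * (X ^ 2 * Mw x * ‖zeroTerm ρ 1‖) := by
          rw [setIntegral_const, Real.volume_real_Ioc_of_le hxX, smul_eq_mul]
  have hsum : Summable fun ρ : Zeros ↦ ∫ t in Ioc x X, ‖zeroTerm ρ t * (w0' t : ℂ)‖ :=
    ((hs1.mul_left (X ^ 2 * Mw x)).mul_left (X - x)).of_nonneg_of_le
      (fun ρ ↦ integral_nonneg fun t ↦ norm_nonneg _) hbound
  have h := integral_tsum_of_summable_integral_norm (μ := volume.restrict (Ioc x X))
    (F := fun (ρ : Zeros) (t : ℝ) ↦ zeroTerm ρ t * (w0' t : ℂ))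
    (fun ρ ↦ (integrableOn_zeroTerm_mul_w0' ρ hx).mono_set Ioc_subset_Ioi_self) hsum
  rw [h]
  refine integral_congr_ae (ae_of_all _ fun t ↦ ?_)
  simp only [Zsum]
  exact tsum_mul_right.symm

/-- **The zeros' part on a finite interval** (RH-free): for `1 < x ≤ X`,
`Z(x)w₀(x) + ∫_x^X Z w₀' − Z(X)w₀(X) = −Σ_ρ (m/ρ)F_ρ(x) + Σ_ρ (m/ρ)F_ρ(X)`. -/
theorem zeros_part_interval {x X : ℝ} (hx : 1 < x) (hxX : x ≤ X) :
    Zsum x * (w0 x : ℂ) + (∫ t in x..X, Zsum t * (w0' t : ℂ)) - Zsum X * (w0 X : ℂ) =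
      -(∑' ρ : Zeros, (riemannZetaZeroOrder (ρ : ℂ) : ℂ) / (ρ : ℂ) * Fz (ρ : ℂ) x) +
        (∑' ρ : Zeros, (riemannZetaZeroOrder (ρ : ℂ) : ℂ) / (ρ : ℂ) * Fz (ρ : ℂ) X) := by
  have hX : 1 < X := hx.trans_le hxX
  have ha : Summable fun ρ : Zeros ↦ zeroTerm ρ x * (w0 x : ℂ) := (summable_zeroTerm hx.le).mul_right _
  have hc : Summable fun ρ : Zeros ↦ zeroTerm ρ X * (w0 X : ℂ) := (summable_zeroTerm hX.le).mul_right _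
  have hfx := summable_term hx
  have hfX := summable_term hX
  have hper := fun ρ : Zeros ↦ one_zero_interval ρ hx hxX
  have hb : Summable fun ρ : Zeros ↦ ∫ t in x..X, zeroTerm ρ t * (w0' t : ℂ) := by
    have h := ((hfx.neg.add hfX).sub ha).add hc
    refine h.congr fun ρ ↦ ?_
    have := hper ρ
    linear_combination -this
  rw [integral_Zsum_mul_w0'_interval hx hxX, Zsum, Zsum, ← tsum_mul_right, ← tsum_mul_right,
    ← ha.tsum_add hb, ← (ha.add hb).tsum_sub hc, ← tsum_neg, ← hfx.neg.tsum_add hfX]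
  exact tsum_congr hper

/-- **S1 PROVED (RH-free)** (scratch `ExplicitFormulaFree`, spelled out): the explicit formula for `J` in limit form —
for `x > 1` the series `Σ_ρ (m/ρ)F_ρ(x)` converges, the improper integral `lim_X ∫_x^X (ψ(t) − t) w₀(t) dt` exists, and
it is `≥ Re(−Σ_ρ (m/ρ)F_ρ(x)) − log(2π)/(x log x)`. -/
theorem explicitFormulaFree_holds :
    ∀ x : ℝ, 1 < x →
    Summable (fun ρ : Zeros ↦ (riemannZetaZeroOrder (ρ : ℂ) : ℂ) / (ρ : ℂ) * Fz (ρ : ℂ) x) ∧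
    ∃ L : ℝ, Tendsto (fun X : ℝ ↦ ∫ t in x..X, (ψ t - t) * w0 t) atTop (𝓝 L) ∧
      (-∑' ρ : Zeros, (riemannZetaZeroOrder (ρ : ℂ) : ℂ) / (ρ : ℂ) * Fz (ρ : ℂ) x).re
        - Real.log (2 * π) / (x * Real.log x) ≤ L := by
  intro x hx
  refine ⟨summable_term hx, ?_⟩
  have hx0 : 0 < x := by linarith
  have hlx : 0 < Real.log x := Real.log_pos hx
  obtain ⟨C, hC0, hC⟩ := exists_norm_psiOneRemainder_le
  -- integrability on `(x, ∞)` of the linear and remainder pieces (RH-free)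
  obtain ⟨hiLr, hL⟩ := linear_term hx
  have hiL : IntegrableOn (fun t : ℝ ↦ (t : ℂ) * (w0' t : ℂ)) (Ioi x) := by
    have h0 : IntegrableOn (fun t : ℝ ↦ ((t * w0' t : ℝ) : ℂ)) (Ioi x) := hiLr.ofReal (𝕜 := ℂ)
    exact h0.congr_fun (fun t _ ↦ by push_cast; ring) measurableSet_Ioi
  have hiE := integrableOn_psiOneRemainder_mul_w0' hx hC
  have hE := re_remainder_bracket_nonpos hx hC
  have hLC : (x : ℂ) * (w0 x : ℂ) + ∫ t in Ioi x, (t : ℂ) * (w0' t : ℂ) = ((-(1 / (x * Real.log x)) : ℝ) : ℂ) := by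
    rw [← hL]
    push_cast
    rw [← integral_complex_ofReal]
    congr 1
    refine setIntegral_congr_fun measurableSet_Ioi fun t _ ↦ ?_
    push_cast; ring
  -- the limit value
  obtain ⟨Lc, hLc⟩ : ∃ Lc : ℂ, Lc = -(∑' ρ : Zeros, (riemannZetaZeroOrder (ρ : ℂ) : ℂ) / (ρ : ℂ) * Fz (ρ : ℂ) x)
      + Complex.log (2 * π) * ((x : ℂ) * (w0 x : ℂ) + ∫ t in Ioi x, (t : ℂ) * (w0' t : ℂ))
      - (psiOneRemainder x * (w0 x : ℂ) + ∫ t in Ioi x, psiOneRemainder t * (w0' t : ℂ)) := ⟨_, rfl⟩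
  refine ⟨Lc.re, ?_, ?_⟩
  swap
  · -- the inequality: `Re` of the remainder's bracket is `≤ 0`
    have hre : Lc.re = (-(∑' ρ : Zeros, (riemannZetaZeroOrder (ρ : ℂ) : ℂ) / (ρ : ℂ) * Fz (ρ : ℂ) x)).re - Real.log (2 * π) / (x * Real.log x)
        - (psiOneRemainder x * (w0 x : ℂ) + ∫ t in Ioi x, psiOneRemainder t * (w0' t : ℂ)).re := by
      rw [hLc, hLC, log_two_pi, sub_re, add_re, ← Complex.ofReal_mul, Complex.ofReal_re]
      ring
    rw [hre]
    linarith
  -- the pieces and their limits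
  have hT1 : Tendsto (fun y : ℝ ↦ ∑' ρ : Zeros, (riemannZetaZeroOrder (ρ : ℂ) : ℂ) / (ρ : ℂ) * Fz (ρ : ℂ) y) atTop (𝓝 0) :=
    tendsto_termSum
  have hw0b : ∀ X, x ≤ X → w0 X ≤ (1 / Real.log x + 1 / Real.log x ^ 2) / X ^ 2 := fun X hX ↦ w0_le hx hX
  have hT2 : Tendsto (fun X : ℝ ↦ (X : ℂ) * (w0 X : ℂ)) atTop (𝓝 0) := by
    have hr : Tendsto (fun X : ℝ ↦ X * w0 X) atTop (𝓝 0) := by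
      have hmaj : Tendsto (fun X : ℝ ↦ (1 / Real.log x + 1 / Real.log x ^ 2) * X⁻¹) atTop (𝓝 0) := by
        have h := tendsto_inv_atTop_zero.const_mul (1 / Real.log x + 1 / Real.log x ^ 2)
        rw [mul_zero] at h
        exact h
      refine squeeze_zero_norm' ?_ hmaj
      filter_upwards [eventually_ge_atTop x] with X hX
      have hX0 : 0 < X := hx0.trans_le hX
      rw [Real.norm_eq_abs, abs_of_pos (mul_pos hX0 (w0_pos (hx.trans_le hX)))]
      calc X * w0 X ≤ X * ((1 / Real.log x + 1 / Real.log x ^ 2) / X ^ 2) :=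
            mul_le_mul_of_nonneg_left (hw0b X hX) hX0.le
        _ = (1 / Real.log x + 1 / Real.log x ^ 2) * X⁻¹ := by field_simp
    have h2 := (Complex.continuous_ofReal.tendsto 0).comp hr
    rw [Complex.ofReal_zero] at h2
    exact h2.congr fun X ↦ by simp only [Function.comp_apply, Complex.ofReal_mul]
  have hT3 : Tendsto (fun X : ℝ ↦ ∫ t in x..X, (t : ℂ) * (w0' t : ℂ)) atTop
      (𝓝 (∫ t in Ioi x, (t : ℂ) * (w0' t : ℂ))) := intervalIntegral_tendsto_integral_Ioi x hiL tendsto_id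
  have hT4 : Tendsto (fun X : ℝ ↦ psiOneRemainder X * (w0 X : ℂ)) atTop (𝓝 0) := by
    have hmaj : Tendsto (fun X : ℝ ↦ C * (1 / Real.log x + 1 / Real.log x ^ 2) * X ^ (-(3 / 2) : ℝ))
        atTop (𝓝 0) := by
      have h := (tendsto_rpow_neg_atTop (y := (3 / 2 : ℝ)) (by norm_num)).const_mul
        (C * (1 / Real.log x + 1 / Real.log x ^ 2))
      rw [mul_zero] at h
      exact h
    refine squeeze_zero_norm' ?_ hmaj
    filter_upwards [eventually_ge_atTop x] with X hX
    have hX0 : 0 < X := hx0.trans_le hX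
    rw [norm_mul, Complex.norm_real, Real.norm_eq_abs, abs_of_pos (w0_pos (hx.trans_le hX))]
    calc ‖psiOneRemainder X‖ * w0 X ≤ (C * Real.sqrt X) * ((1 / Real.log x + 1 / Real.log x ^ 2) / X ^ 2) :=
          mul_le_mul (hC X hX0) (hw0b X hX) (w0_pos (hx.trans_le hX)).le (by positivity)
      _ = C * (1 / Real.log x + 1 / Real.log x ^ 2) * X ^ (-(3 / 2) : ℝ) := by
          rw [Real.sqrt_eq_rpow, show (X ^ 2 : ℝ) = X ^ (1 / 2 : ℝ) * X ^ (3 / 2 : ℝ) by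
              rw [← Real.rpow_add hX0]; norm_num, Real.rpow_neg hX0.le]
          have : X ^ (3 / 2 : ℝ) ≠ 0 := (Real.rpow_pos_of_pos hX0 _).ne'
          have : X ^ (1 / 2 : ℝ) ≠ 0 := (Real.rpow_pos_of_pos hX0 _).ne'
          field_simp
  have hT5 : Tendsto (fun X : ℝ ↦ ∫ t in x..X, psiOneRemainder t * (w0' t : ℂ)) atTop
      (𝓝 (∫ t in Ioi x, psiOneRemainder t * (w0' t : ℂ))) :=
    intervalIntegral_tendsto_integral_Ioi x hiE tendsto_id
  -- the decomposed expression and its limit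
  obtain ⟨EXPR, hEXPR⟩ : ∃ F : ℝ → ℂ, F = fun X ↦ (-(∑' ρ : Zeros, (riemannZetaZeroOrder (ρ : ℂ) : ℂ) / (ρ : ℂ) * Fz (ρ : ℂ) x) + (∑' ρ : Zeros, (riemannZetaZeroOrder (ρ : ℂ) : ℂ) / (ρ : ℂ) * Fz (ρ : ℂ) X))
      - Complex.log (2 * π) *
          ((X : ℂ) * (w0 X : ℂ) - (x : ℂ) * (w0 x : ℂ) - ∫ t in x..X, (t : ℂ) * (w0' t : ℂ))
      + (psiOneRemainder X * (w0 X : ℂ) - psiOneRemainder x * (w0 x : ℂ)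
          - ∫ t in x..X, psiOneRemainder t * (w0' t : ℂ)) := ⟨_, rfl⟩
  have hlimE : Tendsto EXPR atTop (𝓝 Lc) := by
    have h := (((tendsto_const_nhds (x := -(∑' ρ : Zeros, (riemannZetaZeroOrder (ρ : ℂ) : ℂ) / (ρ : ℂ) * Fz (ρ : ℂ) x))).add hT1).sub
      (((hT2.sub (tendsto_const_nhds (x := (x : ℂ) * (w0 x : ℂ)))).sub hT3).const_mul
        (Complex.log (2 * π)))).add
      ((hT4.sub (tendsto_const_nhds (x := psiOneRemainder x * (w0 x : ℂ)))).sub hT5)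
    have e : -(∑' ρ : Zeros, (riemannZetaZeroOrder (ρ : ℂ) : ℂ) / (ρ : ℂ) * Fz (ρ : ℂ) x) + 0
        - Complex.log (2 * π) * (0 - (x : ℂ) * (w0 x : ℂ) - ∫ t in Ioi x, (t : ℂ) * (w0' t : ℂ))
        + (0 - psiOneRemainder x * (w0 x : ℂ) - ∫ t in Ioi x, psiOneRemainder t * (w0' t : ℂ)) = Lc := by
      rw [hLc]; ring
    rw [hEXPR, ← e]
    exact h
  -- `G = EXPR` on `[x, ∞)`
  have hG : ∀ X, x ≤ X → ((∫ t in x..X, (ψ t - t) * w0 t : ℝ) : ℂ) = EXPR X := by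
    intro X hxX
    have hX : 1 < X := hx.trans_le hxX
    have hIcc : uIcc x X = Icc x X := uIcc_of_le hxX
    rw [integral_R_mul_w0_eq hx hxX, Complex.ofReal_sub, Complex.ofReal_sub, Complex.ofReal_mul,
      Complex.ofReal_mul, ← intervalIntegral.integral_ofReal]
    -- substitute the explicit formula inside the integral and at the endpoints
    have hinside : ∫ t in x..X, ((Rone t * w0' t : ℝ) : ℂ) =
        ∫ t in x..X, (-(Zsum t * (w0' t : ℂ)) - Complex.log (2 * π) * ((t : ℂ) * (w0' t : ℂ))
          + psiOneRemainder t * (w0' t : ℂ)) := by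
      refine intervalIntegral.integral_congr fun t ht ↦ ?_
      rw [hIcc] at ht
      push_cast
      rw [Rone_eq_explicit (hx.le.trans ht.1)]; ring
    -- interval integrability of the three pieces (continuity on `[x, X]`)
    have hw0'c : ContinuousOn (fun t : ℝ ↦ (w0' t : ℂ)) (uIcc x X) := by
      rw [hIcc]
      exact Complex.continuous_ofReal.comp_continuousOn (continuousOn_w0'.mono fun t ht ↦ hx.trans_le ht.1)
    have hiZ : IntervalIntegrable (fun t : ℝ ↦ -(Zsum t * (w0' t : ℂ))) volume x X := by
      refine (ContinuousOn.mul ?_ hw0'c).intervalIntegrable.neg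
      rw [hIcc]; exact continuousOn_Zsum.mono fun t ht ↦ (hx.le.trans ht.1)
    have hiLi : IntervalIntegrable (fun t : ℝ ↦ Complex.log (2 * π) * ((t : ℂ) * (w0' t : ℂ))) volume x X := by
      refine ((ContinuousOn.mul ?_ hw0'c).intervalIntegrable).const_mul _
      exact Complex.continuous_ofReal.continuousOn
    have hiEi : IntervalIntegrable (fun t : ℝ ↦ psiOneRemainder t * (w0' t : ℂ)) volume x X := by
      refine (ContinuousOn.mul ?_ hw0'c).intervalIntegrable
      rw [hIcc]; exact continuousOn_psiOneRemainder.mono fun t ht ↦ (hx.le.trans ht.1)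
    rw [hinside, intervalIntegral.integral_add (hiZ.sub hiLi) hiEi, intervalIntegral.integral_sub hiZ hiLi,
      intervalIntegral.integral_neg, intervalIntegral.integral_const_mul,
      Rone_eq_explicit hx.le, Rone_eq_explicit hX.le, hEXPR]
    have hZ := zeros_part_interval hx hxX
    beta_reduce
    linear_combination hZ
  have hGlim : Tendsto (fun X : ℝ ↦ ((∫ t in x..X, (ψ t - t) * w0 t : ℝ) : ℂ)) atTop (𝓝 Lc) := by
    refine hlimE.congr' ?_
    filter_upwards [eventually_ge_atTop x] with X hX
    exact (hG X hX).symm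
  have hre := (Complex.continuous_re.tendsto Lc).comp hGlim
  exact hre.congr fun X ↦ by simp only [Function.comp_apply, Complex.ofReal_re]

end Summit.RiemannHypothesis.RiemannHypothesis.Theorems.Splittings.RobinFiniteE1c

end
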